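import Literature.AlgebraicGeometry.Motives.AbelianVarietyLatticeTensorIsogeny
import HarnessLib

/-!
# The endomorphism ring of a lattice tensor: `End(Y^ι) ≅ M_ι(End Y)` as RINGS (Mumford §19 Cor. 2), the ring embedding
# `M_ι(ℤ) = End_ℤ(M) ↪ End(Y ⊗ M)` (Mazur–Rubin–Silverberg Prop. 1.6, Thm. 1.8), its image in `End_G(Y ⊗_β M)` = the commutant
# `End_{ℤ[G]}(M)`, and the action itself as `ρ(g) = Ψ(m(g) ⊗ β(g))`, `ρ = Φ ∘ m` (Def. 1.1; Milne 1972 §2)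

Sequel of `Motives/AbelianVarietyLatticeTensorIsogeny` (intertwiners ⟷ equivariant maps) and the ring-theoretic form of
`Motives/AbelianVarietyLatticeTensorCoordinates` §1 (the additive isomorphism `Hom(Y ⊗ M, Y' ⊗ N) ≅ M_{κ×ι}(Hom(Y, Y'))`).  For a power
`X = Y^ι` presented by a bicone `b` with `Σ π_i ι_i = 𝟙` (no definitions; all maps produced as existence statements with their block
formulas `ι_j ≫ F ≫ π_i`):

* §1 **Mumford §19 Cor. 2: `Ψ : M_ι(End Y) ≃+* End(Y^ι)`**, `ι_j ≫ Ψ(A) ≫ π_i = A_{ij}`, `Ψ⁻¹(F)_{ij} = ι_j ≫ F ≫ π_i`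
  (`exists_ringEquiv_matrix_end`: matrix multiplication in `M_ι(End Y)` — with `End`'s multiplication `f * g = g ≫ f` — is block
  composition); in particular `End(Y^ι)` is determined by `End(Y)` ("`End⁰(A^n) = M_n(End⁰ A)`");
* §2 **MRS Prop. 1.6 (ii)/(iii), Thm. 1.8: the ring homomorphism `Φ : M_ι(ℤ) →+* End(Y^ι)`, `ι_j ≫ Φ(A) ≫ π_i = A_{ij} • 𝟙_Y`**
  (`exists_ringHom_intMatrix`, `Φ = Ψ ∘ M_ι(ℤ → End Y)`), INJECTIVE when `dim Y > 0` (`ringHom_intMatrix_injective`: "if `𝒪 → End_k(V)` is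
  injective then so is `End_𝒪(I) → End_k(I ⊗ V)`");
* §3 the ACTION through these rings: for a lattice tensor `Y ⊗_β M` (action `ρ`, `ι_j ρ(g) π_i = m(g)_{ij} • β(g)`)
  **`ρ(g) = Ψ((m(g)_{ij} • β(g))_{ij}) = Ψ(m(g) ⊗ β(g))`** (`asHom_action_eq_ringEquiv_apply`, MRS Def. 1.1 "`γ ↦ γ_I ⊗ γ_V`"), and for the
  untwisted tensor **`ρ = Φ ∘ m`** as monoid homomorphisms `G → End(Y^ι)` (`action_eq_ringHom_comp`: "`G` acts on `Y ⊗ M` through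
  `m : G → GL_ι(ℤ) ⊆ M_ι(ℤ) → End(Y^ι)`", Milne 1972 §2);
* §4 the COMMUTANT: **`Φ(A)` is `G`-equivariant on `Y ⊗_β M` iff `A m(g) = m(g) A` for all `g`** (`ringHom_intMatrix_comm_iff`, `dim Y > 0`
  for "only if"; any twist `β`) — `Φ` restricts to `End_{ℤ[G]}(M) ↪ End_G(Y ⊗_β M)` (MRS Cor. 1.7 (ii)/(iii) with `I = J`).

## References

* [MumfordAV1970] D. Mumford, *Abelian Varieties* (1970), §19, p. 173 (homomorphisms of products as matrices) and Cor. 2 (p. 174: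
  `End⁰(A^n) = M_n(End⁰ A)`).
* [MazurRubinSilverberg2007] B. Mazur, K. Rubin, A. Silverberg, *Twisting commutative algebraic groups*, J. Algebra 314 (2007)
  419–438: Def. 1.1, Prop. 1.6 ("(i) natural isomorphisms `M_{m×n}(Hom_k(V, W)) ≅ Hom_k(V^n, W^m)` … (ii) `R`-module homomorphisms,
  (iii) if `𝒪 → End_k(V)` is injective then the maps are injective"), Cor. 1.7, Thm. 1.8 (`I ↦ I ⊗_𝒪 V` is a functor;
  `End_𝒪(I) → End_k(I ⊗_𝒪 V)`).  Held: `paper:doi-10-1016-j-jalgebra-2007-02-052`, PDF pp. 3–5 read 2026-08-28.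
* [Milne1972ArithmeticAV] J. S. Milne, *On the arithmetic of abelian varieties*, Invent. Math. 17 (1972), §2 (the action of `G` on
  `M ⊗ A` through `M`), as reported by [MazurRubinSilverberg2007].
* [SerreLinearRepresentations1977] J.-P. Serre, *Linear Representations of Finite Groups*, GTM 42 (1977), §1.1 (matrix form `R_s`),
  §2.2 (commutant; Schur).
-/

noncomputable section

open CategoryTheory CategoryTheory.Limits
open Literature.NumberTheory.DiophantineGeometry
open Literature.RepresentationTheory.FiniteGroups

universe u

namespace Literature.AlgebraicGeometry.Motives

namespace AbelianVariety

namespace LatticeTensor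

variable {K : Type u} [Field K] {Y : AbelianVariety K} {ι : Type} [Fintype ι] [DecidableEq ι] (b : Bicone (fun _ : ι ↦ Y))

/-! ## §1 `End(Y^ι) ≅ M_ι(End Y)` as rings (Mumford §19 Cor. 2) -/

omit [DecidableEq ι] in
/-- Blocks of a composite endomorphism: `ι_j ≫ (F ≫ F') ≫ π_i = Σ_k (ι_j F π_k) ≫ (ι_k F' π_i)` (insert `𝟙 = Σ_k π_k ι_k`) — matrix
multiplication of block matrices. [cite: MumfordAV1970, §19 (p. 173)] -/
theorem ι_comp_comp_comp_π_eq_sum (hb : ∑ j, b.π j ≫ b.ι j = 𝟙 b.pt) (F F' : b.pt ⟶ b.pt) (i j : ι) :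
    b.ι j ≫ (F ≫ F') ≫ b.π i = ∑ k, (b.ι j ≫ F ≫ b.π k) ≫ (b.ι k ≫ F' ≫ b.π i) := by
  conv_lhs => rw [← Category.id_comp F', ← hb]
  simp only [Preadditive.sum_comp, Preadditive.comp_sum, Category.assoc]

omit [DecidableEq ι] in
/-- **Mumford §19 Cor. 2: `End(Y^ι) ≅ M_ι(End Y)` as rings.**  For a power `Y^ι` (bicone `b`, `Σ π_i ι_i = 𝟙`) there is a ring
isomorphism **`Ψ : Matrix ι ι (End Y) ≃+* End(Y^ι)` with `ι_j ≫ Ψ(A) ≫ π_i = A_{ij}` and `Ψ⁻¹(F)_{ij} = ι_j ≫ F ≫ π_i`**: block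
composition is matrix multiplication for `End`'s multiplication `f * g = g ≫ f` ("`End⁰(A^n)` is equal to the matrix algebra
`M_n(End⁰ A)`", integrally).  `Ψ(A) = Σ_j π_j ≫ Σ_i A_{ij} ≫ ι_i`. [cite: MumfordAV1970, §19 (p. 173) and Cor. 2 (p. 174)]
[cite: MazurRubinSilverberg2007, Prop. 1.6 (i)] -/
theorem exists_ringEquiv_matrix_end (hb : ∑ j, b.π j ≫ b.ι j = 𝟙 b.pt) :
    ∃ Ψ : Matrix ι ι (End Y) ≃+* End b.pt,
      (∀ A i j, b.ι j ≫ End.asHom (Ψ A) ≫ b.π i = End.asHom (A i j)) ∧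
      ∀ F i j, Ψ.symm F i j = End.of (b.ι j ≫ End.asHom F ≫ b.π i) := by
  -- the candidate and its blocks
  let ψ : Matrix ι ι (End Y) → (b.pt ⟶ b.pt) := fun A ↦ ∑ j, b.π j ≫ ∑ i, End.asHom (A i j) ≫ b.ι i
  have hψ : ∀ A i j, b.ι j ≫ ψ A ≫ b.π i = End.asHom (A i j) := fun A i j ↦
    ι_comp_matrix_comp_π b b (fun j i ↦ End.asHom (A i j)) j i
  refine ⟨{ toFun := fun A ↦ End.of (ψ A)
            invFun := fun F ↦ Matrix.of fun i j ↦ End.of (b.ι j ≫ End.asHom F ≫ b.π i)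
            left_inv := fun A ↦ ?_
            right_inv := fun F ↦ ?_
            map_mul' := fun A B ↦ ?_
            map_add' := fun A B ↦ ?_ }, fun A i j ↦ hψ A i j, fun F i j ↦ rfl⟩
  · ext i j
    exact hψ A i j
  · change ψ _ = End.asHom F
    exact hom_ext_matrix b b hb hb fun j i ↦ by rw [hψ]; rfl
  · change ψ (A * B) = ψ B ≫ ψ A
    refine hom_ext_matrix b b hb hb fun j i ↦ ?_
    rw [hψ, ι_comp_comp_comp_π_eq_sum b hb, Matrix.mul_apply]
    simp only [hψ]
    rfl
  · change ψ (A + B) = ψ A + ψ B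
    refine hom_ext_matrix b b hb hb fun j i ↦ ?_
    rw [hψ, Preadditive.add_comp, Preadditive.comp_add, hψ, hψ, Matrix.add_apply]
    rfl

/-! ## §2 The ring embedding `M_ι(ℤ) ↪ End(Y^ι)` (MRS Prop. 1.6, Thm. 1.8) -/

/-- **MRS Prop. 1.6 (ii) / Thm. 1.8: the ring homomorphism `Φ : M_ι(ℤ) = End_ℤ(M) →+* End(Y ⊗ M)`, `ι_j ≫ Φ(A) ≫ π_i = A_{ij} • 𝟙_Y`**
(`Φ = Ψ ∘ M_ι(ℤ → End Y)`; "the map `I ↦ I ⊗_𝒪 V` is a functor", on endomorphisms). [cite: MazurRubinSilverberg2007, Prop. 1.6 (ii) and Thm. 1.8]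
[cite: MumfordAV1970, §19 (p. 173)] -/
theorem exists_ringHom_intMatrix (hb : ∑ j, b.π j ≫ b.ι j = 𝟙 b.pt) :
    ∃ Φ : Matrix ι ι ℤ →+* End b.pt, ∀ A i j, b.ι j ≫ End.asHom (Φ A) ≫ b.π i = A i j • 𝟙 Y := by
  obtain ⟨Ψ, hΨ, -⟩ := exists_ringEquiv_matrix_end b hb
  refine ⟨Ψ.toRingHom.comp (Int.castRingHom (End Y)).mapMatrix, fun A i j ↦ ?_⟩
  rw [RingHom.comp_apply, RingEquiv.toRingHom_eq_coe, RingEquiv.coe_toRingHom, hΨ, RingHom.mapMatrix_apply, Matrix.map_apply,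
    eq_intCast, ← zsmul_one]
  rfl

omit [DecidableEq ι] in
/-- **The scalar-block map is determined by its blocks**: any two ring homomorphisms / maps `M_ι(ℤ) → End(Y^ι)` with
`ι_j ≫ Φ(A) ≫ π_i = A_{ij} • 𝟙_Y` agree (so the `Φ` above is THE functorial map `A ↦ A_Y` of the prequels).
[cite: MazurRubinSilverberg2007, Prop. 1.6 (ii)] [cite: MumfordAV1970, §19 (p. 173)] -/
theorem ringHom_intMatrix_unique (hb : ∑ j, b.π j ≫ b.ι j = 𝟙 b.pt) {Φ Φ' : Matrix ι ι ℤ → End b.pt}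
    (hΦ : ∀ A i j, b.ι j ≫ End.asHom (Φ A) ≫ b.π i = A i j • 𝟙 Y) (hΦ' : ∀ A i j, b.ι j ≫ End.asHom (Φ' A) ≫ b.π i = A i j • 𝟙 Y) :
    Φ = Φ' :=
  funext fun A ↦ hom_ext_matrix b b hb hb fun j i ↦ by
    change b.ι j ≫ End.asHom (Φ A) ≫ b.π i = b.ι j ≫ End.asHom (Φ' A) ≫ b.π i
    rw [hΦ, hΦ']

omit [Fintype ι] [DecidableEq ι] in
/-- **MRS Prop. 1.6 (iii) / Thm. 1.8: `Φ : M_ι(ℤ) → End(Y^ι)` is injective for `Y ≠ 0`** ("if the map `𝒪 → End_k(V)` is injective,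
then the maps in (i) and (ii) are injective"; here `ℤ → End Y`, `a ↦ a • 𝟙`, is injective for `dim Y > 0`).
[cite: MazurRubinSilverberg2007, Prop. 1.6 (iii) and Thm. 1.8] -/
theorem ringHom_intMatrix_injective (hY : 0 < Y.dim) {Φ : Matrix ι ι ℤ → End b.pt}
    (hΦ : ∀ A i j, b.ι j ≫ End.asHom (Φ A) ≫ b.π i = A i j • 𝟙 Y) : Function.Injective Φ := by
  intro A B h
  ext i j
  refine zsmul_id_injective hY ?_
  rw [← hΦ A i j, ← hΦ B i j, h]

/-! ## §3 The action through `Ψ` and `Φ`: `ρ(g) = Ψ(m(g) ⊗ β(g))`, `ρ = Φ ∘ m` -/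

variable {G : Type} [Group G] (m : G →* Matrix ι ι ℤ) (β : G →* End Y) (ρ : G →* End b.pt)

/-- **MRS Def. 1.1 inside `End(Y^ι) = M_ι(End Y)`: `ρ(g) = Ψ((m(g)_{ij} • β(g))_{ij}) = Ψ(m(g) ⊗ β(g))`** for the lattice tensor
`Y ⊗_β M` ("`γ` acts on `I ⊗ V` by `γ_I ⊗ γ_V`") — for ANY `Ψ` with the block property of §1. [cite: MazurRubinSilverberg2007, Def. 1.1]
[cite: MumfordAV1970, §19 Cor. 2 (p. 174)] -/
theorem asHom_action_eq_ringEquiv_apply (hb : ∑ j, b.π j ≫ b.ι j = 𝟙 b.pt)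
    (hρ : ∀ (g : G) (i j : ι), b.ι j ≫ End.asHom (ρ g) ≫ b.π i = m g i j • End.asHom (β g))
    {Ψ : Matrix ι ι (End Y) → End b.pt} (hΨ : ∀ A i j, b.ι j ≫ End.asHom (Ψ A) ≫ b.π i = End.asHom (A i j)) (g : G) :
    ρ g = Ψ (Matrix.of fun i j ↦ End.of (m g i j • End.asHom (β g))) :=
  hom_ext_matrix b b hb hb fun j i ↦ by
    change b.ι j ≫ End.asHom (ρ g) ≫ b.π i = b.ι j ≫ End.asHom (Ψ _) ≫ b.π i
    rw [hρ, hΨ, Matrix.of_apply]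

/-- **Milne's description: `G` acts on `Y ⊗ M = Y^ι` through `m : G → GL_ι(ℤ) ⊆ M_ι(ℤ) →Φ End(Y^ι)`** — for the untwisted tensor
(`ι_j ρ(g) π_i = m(g)_{ij} • 𝟙`) and ANY map `Φ` with the block property of §2, **`ρ(g) = Φ(m(g))`**; with the ring homomorphism `Φ` of
`exists_ringHom_intMatrix` this is `ρ = Φ ∘ m` as monoid homomorphisms. [cite: Milne1972ArithmeticAV, §2] [cite: MazurRubinSilverberg2007, Def. 1.1] -/
theorem action_eq_ringHom_apply (hb : ∑ j, b.π j ≫ b.ι j = 𝟙 b.pt)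
    (hρ₁ : ∀ (g : G) (i j : ι), b.ι j ≫ End.asHom (ρ g) ≫ b.π i = m g i j • 𝟙 Y)
    {Φ : Matrix ι ι ℤ → End b.pt} (hΦ : ∀ A i j, b.ι j ≫ End.asHom (Φ A) ≫ b.π i = A i j • 𝟙 Y) (g : G) :
    ρ g = Φ (m g) :=
  hom_ext_matrix b b hb hb fun j i ↦ by
    change b.ι j ≫ End.asHom (ρ g) ≫ b.π i = b.ι j ≫ End.asHom (Φ _) ≫ b.π i
    rw [hρ₁, hΦ]

/-- `ρ = Φ ∘ m : G →* End(Y^ι)` for the ring homomorphism `Φ : M_ι(ℤ) →+* End(Y^ι)` (untwisted tensor).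
[cite: Milne1972ArithmeticAV, §2] [cite: MazurRubinSilverberg2007, Def. 1.1 and Thm. 1.8] -/
theorem action_eq_ringHom_comp (hb : ∑ j, b.π j ≫ b.ι j = 𝟙 b.pt)
    (hρ₁ : ∀ (g : G) (i j : ι), b.ι j ≫ End.asHom (ρ g) ≫ b.π i = m g i j • 𝟙 Y)
    {Φ : Matrix ι ι ℤ →+* End b.pt} (hΦ : ∀ A i j, b.ι j ≫ End.asHom (Φ A) ≫ b.π i = A i j • 𝟙 Y) :
    ρ = (Φ : Matrix ι ι ℤ →* End b.pt).comp m :=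
  MonoidHom.ext fun g ↦ action_eq_ringHom_apply b m ρ hb hρ₁ hΦ g

/-- Conversely **every matrix representation acts**: `Φ ∘ m` IS a lattice action with blocks `m(g)_{ij} • 𝟙` (the untwisted `Y ⊗ M`
realised inside the ring `End(Y^ι)`; cf. `exists_action` of `Motives/AbelianVarietyLatticeTensor`). [cite: Milne1972ArithmeticAV, §2]
[cite: MazurRubinSilverberg2007, Def. 1.1] -/
theorem ringHom_comp_blocks {Φ : Matrix ι ι ℤ →+* End b.pt} (hΦ : ∀ A i j, b.ι j ≫ End.asHom (Φ A) ≫ b.π i = A i j • 𝟙 Y)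
    (g : G) (i j : ι) :
    b.ι j ≫ End.asHom (((Φ : Matrix ι ι ℤ →* End b.pt).comp m) g) ≫ b.π i = m g i j • 𝟙 Y :=
  hΦ (m g) i j

/-! ## §4 The commutant: `Φ(End_{ℤ[G]}(M)) = Φ(M_ι(ℤ)) ∩ End_G(Y ⊗_β M)` -/

/-- **`Φ(A)` is `G`-equivariant on `Y ⊗_β M` iff `A ∈ End_{ℤ[G]}(M)`**: for `dim Y > 0` and ANY twist `β`,
**`ρ(g) ≫ Φ(A) = Φ(A) ≫ ρ(g) for all g ⟺ A m(g) = m(g) A for all g`** (MRS Cor. 1.7 (ii) gives `⇐` for every `Y`; (iii) gives `⇒`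
when `ℤ → End Y` is injective) — `Φ` restricts to a ring embedding `End_{ℤ[G]}(M) ↪ End_G(Y ⊗_β M)`.
[cite: MazurRubinSilverberg2007, Cor. 1.7 (ii), (iii) and Thm. 1.8] [cite: SerreLinearRepresentations1977, §2.2] -/
theorem ringHom_intMatrix_comm_iff (hY : 0 < Y.dim) (hb : ∑ j, b.π j ≫ b.ι j = 𝟙 b.pt)
    (hρ : ∀ (g : G) (i j : ι), b.ι j ≫ End.asHom (ρ g) ≫ b.π i = m g i j • End.asHom (β g))
    {Φ : Matrix ι ι ℤ → End b.pt} (hΦ : ∀ A i j, b.ι j ≫ End.asHom (Φ A) ≫ b.π i = A i j • 𝟙 Y) (A : Matrix ι ι ℤ) :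
    (∀ g : G, End.asHom (ρ g) ≫ End.asHom (Φ A) = End.asHom (Φ A) ≫ End.asHom (ρ g)) ↔ ∀ g : G, A * m g = m g * A :=
  ⟨fun h g ↦ intertwines_of_comm b b m m β ρ ρ hY hb hb hρ hρ (hΦ A) (h g),
    fun h g ↦ comm_of_intertwines b b m m β ρ ρ hb hb hρ hρ (hΦ A) h g⟩

/-- The `⇐` direction for every `Y` (also `Y = 0`): **`A m(g) = m(g) A ⟹ ρ(g) Φ(A) = Φ(A) ρ(g)`** — `End_{ℤ[G]}(M) ⊗ 1 ⊆ End_G(Y ⊗_β M)`.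
[cite: MazurRubinSilverberg2007, Cor. 1.7 (ii)] -/
theorem comm_ringHom_intMatrix_of_comm (hb : ∑ j, b.π j ≫ b.ι j = 𝟙 b.pt)
    (hρ : ∀ (g : G) (i j : ι), b.ι j ≫ End.asHom (ρ g) ≫ b.π i = m g i j • End.asHom (β g))
    {Φ : Matrix ι ι ℤ → End b.pt} (hΦ : ∀ A i j, b.ι j ≫ End.asHom (Φ A) ≫ b.π i = A i j • 𝟙 Y) {A : Matrix ι ι ℤ}
    (hA : ∀ g : G, A * m g = m g * A) (g : G) :
    End.asHom (ρ g) ≫ End.asHom (Φ A) = End.asHom (Φ A) ≫ End.asHom (ρ g) :=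
  comm_of_intertwines b b m m β ρ ρ hb hb hρ hρ (hΦ A) hA g

/-- In ring language: **`A ∈ End_{ℤ[G]}(M) ⟹ Φ(A)` commutes with every `ρ(g)` in the ring `End(Y ⊗_β M)`** (`Φ(A) * ρ(g) = ρ(g) * Φ(A)`).
[cite: MazurRubinSilverberg2007, Cor. 1.7 (ii) and Thm. 1.8] -/
theorem commute_ringHom_intMatrix_action (hb : ∑ j, b.π j ≫ b.ι j = 𝟙 b.pt)
    (hρ : ∀ (g : G) (i j : ι), b.ι j ≫ End.asHom (ρ g) ≫ b.π i = m g i j • End.asHom (β g))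
    {Φ : Matrix ι ι ℤ → End b.pt} (hΦ : ∀ A i j, b.ι j ≫ End.asHom (Φ A) ≫ b.π i = A i j • 𝟙 Y) {A : Matrix ι ι ℤ}
    (hA : ∀ g : G, A * m g = m g * A) (g : G) :
    Commute (Φ A) (ρ g) :=
  comm_ringHom_intMatrix_of_comm b m β ρ hb hρ hΦ hA g

end LatticeTensor

end AbelianVariety

end Literature.AlgebraicGeometry.Motives
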